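import Literature.Computability.Cryptography.RegevSamplerSizes
import Literature.Computability.Cryptography.RegevSamplerSchedule
import Literature.Computability.QuantumComplexity.GRCosineCodeFPClamp
import Literature.Algebra.EuclideanLattices.GapInstanceCodeFP
import HarnessLib

/-!
# Regev 2009, Lemma 3.14 in machine form: the block parameters from the `GapSVP` code

Topic `Literature/Computability/Cryptography`, grouping namespace `Regev2009.SamplerRegs`; sequel of
`RegevSamplerSizes.lean`, `RegevSamplerWidth.lean`, `RegevSamplerSchedule.lean` and `GRCosineCodeFPClamp.lean`.
The small glue facts the assembly of Lemma 3.14 needs to instantiate the per-block machine bound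
(`RegevSamplerMachineSched`) from the data of an input `x = code (B, r)`:

* sizes read off the `GapSVP` code: `|code B| ≤ |x|`, `|r| ≤ 2^{|x|}`, `2^{-|x|} ≤ |r|` (`r ≠ 0`);
* the symmetric width window `2^{-T} ≤ t_k ≤ 2^T` with ONE exponent `T = (b_q+1)L + L_r + b_q` (`tW_window_sym`);
* Regev's promise in width form: `αq/(√2 ρ) < λ₁(L*)/2` gives `√n/t ≤ λ₁(L*)/2` for `t = √2 ρ√n/(αq)` (`promise_tW`);
* the accuracy of the CLAMPED level table `LevelCode.clamp` at scale `S = D_t²/2` for the block's Gaussian parameter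
  `c = 2π/D_t²` (`accurate_clamp`), from `accurate_tableTc` and `two_pi_div_sq_eq`.

Everything here is proved; no named fact is introduced.

## References

* O. Regev, *On lattices, learning with errors, random linear codes, and cryptography*, J. ACM 56 (2009),
  art. 34, Lemma 3.14 (proof), Lemma 3.12 (proof) [Regev2009].
* D. Micciancio, S. Goldwasser, *Complexity of Lattice Problems*, Kluwer 2002, Ch. 1 §1.2 [MicciancioGoldwasser2002].
-/

noncomputable section

namespace Literature.Computability.Cryptography

namespace Regev2009

namespace SamplerRegs

open Literature.Algebra.EuclideanLattices Literature.Algebra.EuclideanLattices.Regev2009 Peikert2009 Finset Module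
  Literature.Computability.QuantumComplexity Literature.Computability.QuantumComplexity.GRMassTable
  Literature.Computability.QuantumComplexity.GaussianCells
  Literature.Computability.Complexity SamplerArith SamplerGeom _root_.Computability
open scoped Real

/-! ### Sizes read off the `GapSVP` code -/

/-- `|code B| ≤ |code (B, r)|`. [cite: MicciancioGoldwasser2002, Ch. 1 §1.2] -/
theorem length_encode_le_gapSVP (I : LatticeInstance) (r : ℚ) : I.encode.length ≤ (GapSVPInstance.encode (I, r)).length := by
  rw [gapSVPInstance_encode_eq, length_boolPair]; omega

/-- `|num r| < 2^{|code (B, r)|}`. [folklore] -/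
theorem natAbs_num_lt_two_pow_gapSVP (I : LatticeInstance) (r : ℚ) : r.num.natAbs < 2 ^ (GapSVPInstance.encode (I, r)).length := by
  have h1 : r.num.natAbs < 2 ^ (encodeNat r.num.natAbs).length := by
    rw [TM2Pass.length_encodeNat_eq_size]; exact Nat.lt_size_self _
  refine lt_of_lt_of_le h1 (Nat.pow_le_pow_right (by norm_num) ?_)
  rw [gapSVPInstance_encode_eq, length_boolPair, length_boolPair, CodeFP.smE_apply, length_boolPair]
  omega

/-- `den r < 2^{|code (B, r)|}`. [folklore] -/
theorem den_lt_two_pow_gapSVP (I : LatticeInstance) (r : ℚ) : r.den < 2 ^ (GapSVPInstance.encode (I, r)).length := by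
  have h1 : r.den < 2 ^ (encodeNat r.den).length := by
    rw [TM2Pass.length_encodeNat_eq_size]; exact Nat.lt_size_self _
  refine lt_of_lt_of_le h1 (Nat.pow_le_pow_right (by norm_num) ?_)
  rw [gapSVPInstance_encode_eq, length_boolPair, length_boolPair]
  omega

/-- **`|r| ≤ 2^{|code (B, r)|}`.** [folklore] -/
theorem abs_cast_le_two_pow_gapSVP (I : LatticeInstance) (r : ℚ) : |(r : ℝ)| ≤ (2 : ℝ) ^ (GapSVPInstance.encode (I, r)).length := by
  have hd : (1 : ℝ) ≤ r.den := by exact_mod_cast r.den_pos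
  calc |(r : ℝ)| ≤ |(r : ℝ)| * r.den := le_mul_of_one_le_right (abs_nonneg _) hd
    _ = (r.num.natAbs : ℝ) := abs_cast_mul_den r
    _ ≤ (2 : ℝ) ^ (GapSVPInstance.encode (I, r)).length := by exact_mod_cast (natAbs_num_lt_two_pow_gapSVP I r).le

/-- **`2^{-|code (B, r)|} ≤ |r|` for `r ≠ 0`.** [folklore] -/
theorem two_pow_inv_le_abs_cast_gapSVP (I : LatticeInstance) {r : ℚ} (hr : r ≠ 0) :
    (2⁻¹ : ℝ) ^ (GapSVPInstance.encode (I, r)).length ≤ |(r : ℝ)| := by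
  have hd0 : (0 : ℝ) < r.den := by exact_mod_cast r.den_pos
  have hnum : (1 : ℝ) ≤ (r.num.natAbs : ℝ) := by
    have : r.num ≠ 0 := Rat.num_ne_zero.2 hr
    exact_mod_cast Int.natAbs_pos.2 this
  have hden : (r.den : ℝ) ≤ (2 : ℝ) ^ (GapSVPInstance.encode (I, r)).length := by
    exact_mod_cast (den_lt_two_pow_gapSVP I r).le
  rw [inv_pow]
  calc ((2 : ℝ) ^ (GapSVPInstance.encode (I, r)).length)⁻¹ ≤ ((r.den : ℝ))⁻¹ := by
        rw [inv_le_inv₀ (by positivity) hd0]; exact hden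
    _ ≤ |(r : ℝ)| := by
        rw [inv_le_iff_one_le_mul₀ hd0, abs_cast_mul_den]; exact hnum

/-! ### The width window with one exponent -/

/-- **The symmetric width window**: `2^{-T} ≤ t_k ≤ 2^T` with `T = (b_q+1)L + L_r + b_q`, for the stage width
`t_k = √2 ρ_k √n/(αq)` at level radius `ρ_k = θ^{L−k} r`. [cite: Regev2009, Lemma 3.14 (proof), Theorem 3.1 (proof)] -/
theorem tW_window_sym {aq θ r : ℝ} {n L k Lr bq : ℕ} (hn : 0 < n) (haq2 : 2 * Real.sqrt n ≤ aq) (haq : aq ≤ (2 : ℝ) ^ bq)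
    (hθ1 : 1 ≤ θ) (hθ : θ ≤ (2 : ℝ) ^ (bq + 1)) (hr' : (2⁻¹ : ℝ) ^ Lr ≤ r) (hr : r ≤ (2 : ℝ) ^ Lr) :
    (2⁻¹ : ℝ) ^ ((bq + 1) * L + Lr + bq) ≤ tW aq (levelRadius θ L r k) n ∧
      tW aq (levelRadius θ L r k) n ≤ (2 : ℝ) ^ ((bq + 1) * L + Lr + bq) := by
  obtain ⟨h1, h2⟩ := tW_window (L := L) (k := k) hn haq2 haq hθ1 hθ hr' hr
  refine ⟨le_trans (pow_le_pow_of_le_one (by norm_num) (by norm_num) (by omega)) h1,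
    h2.trans (pow_le_pow_right₀ one_le_two (by omega))⟩

/-! ### Regev's promise in width form -/

/-- **The promise in width form**: `αq/(√2 ρ) < λ/2` gives `√n/t ≤ λ/2` for `t = √2 ρ √n/(αq)`.
[cite: Regev2009, Lemma 3.14 (statement: "r > √2 q/λ₁(L*)·…")] -/
theorem promise_tW {aq ρ lam : ℝ} {n : ℕ} (haq : 0 < aq) (hρ : 0 < ρ) (hn : 0 < n)
    (h : aq / (Real.sqrt 2 * ρ) < lam / 2) : Real.sqrt n / tW aq ρ n ≤ lam / 2 := by
  rw [sqrt_div_tW haq hρ hn]; exact h.le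

/-! ### The clamped level table at the block's scale -/

variable (I : LatticeInstance)

/-- **The clamped table is accurate for the block**: with `t = √2 ρ√n/(aq)` (`aq, ρ` positive rationals),
`S = Spar 2^{ℓ_R} |det B| aq ρ n` (so `π/S = 2π/D_t²`), `2 ≤ D_t²` and the budget `6(p+ℓ+3) ≤ U`, the table of
`LevelCode.clamp` is `2/2^p`-accurate for `c = 2π/D_t²`. [cite: Regev2009, Lemma 3.12 (proof) with §2 p. 11] -/
theorem accurate_clamp {aq ρ : ℚ} {n ℓR ℓ p U : ℕ} (haq : 0 < aq) (hρ : 0 < ρ) (hn : 0 < n)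
    (h2 : 2 ≤ DT I (2 ^ ℓR) (tW (aq : ℝ) (ρ : ℝ) n) ^ 2) (hU : 6 * (p + ℓ + 3) ≤ U) :
    Accurate (ℓ := ℓ) (2 * π / DT I (2 ^ ℓR) (tW (aq : ℝ) (ρ : ℝ) n) ^ 2)
      (LevelCode.clamp.tab (Spar (2 ^ ℓR) (detA I) aq ρ n) p U ℓ) (2 / (2 : ℝ) ^ p) := by
  rw [two_pi_div_sq_eq I (2 ^ ℓR) haq hρ hn]
  exact accurate_tableTc (one_le_Spar I (2 ^ ℓR) haq hρ hn h2) hU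

/-- The same under the schedule: `2 ≤ D_t²` follows from `2^{ℓ_R − T} ≤ D_t` (`window_sched`, `ℓ_R − T ≥ 2`).
[cite: Regev2009, Lemma 3.12 (proof)] -/
theorem accurate_clamp_sched [IsZLattice ℝ I.lattice] {W : ℕ} (Λ : SamplerClassical.Layout W I.n) {aq ρ : ℚ} {ℓ p U T e m : ℕ}
    (haq : 0 < aq) (hρ : 0 < ρ) (hn : 0 < I.n)
    (htT : tW (aq : ℝ) (ρ : ℝ) I.n ≤ (2 : ℝ) ^ T) (hR : Λ.ℓR = schedR I.n e T m) (hL : Λ.ℓ = schedL I.n e T m)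
    (hU : 6 * (p + ℓ + 3) ≤ U) :
    Accurate (ℓ := ℓ) (2 * π / DT I (2 ^ Λ.ℓR) (tW (aq : ℝ) (ρ : ℝ) I.n) ^ 2)
      (LevelCode.clamp.tab (Spar (2 ^ Λ.ℓR) (detA I) aq ρ I.n) p U ℓ) (2 / (2 : ℝ) ^ p) := by
  have ht : 0 < tW (aq : ℝ) (ρ : ℝ) I.n := tW_pos (by exact_mod_cast haq) (by exact_mod_cast hρ) hn
  obtain ⟨hD, -, hj⟩ := window_sched I Λ ht htT hR hL (m := m) (e := e)
  exact accurate_clamp I haq hρ hn (two_le_sq_of hD (by omega)) hU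

end SamplerRegs

end Regev2009

end Literature.Computability.Cryptography

end
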